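import Mathlib
import Literature.Computability.AlgebraicComplexity.LandsbergRessayreNormalForm
import Summits.ValiantsHypothesis.ValiantsHypothesis.Theorems.RefutationDegreeBeyondHessianNsStubDerivFunctional
import Summits.ValiantsHypothesis.ValiantsHypothesis.Theorems.RefutationDegreeBeyondHessianNsStubMrJetInstance
import Summits.ValiantsHypothesis.ValiantsHypothesis.Theorems.RefutationDegreeBeyondHessianNsJetCalibrationTranslated

/-!
# The kernel plane of a `Λ₀`-pencil, evaluated form (crux `BeyondHessianNs`)

Helper file for crux item stmt-ValiantsHypothesis-5641 (`RefutationDegree.BeyondHessianNs`),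
stub `stub_kernelPlaneEval` (S4) of the line `Sketch`.

Let `m = ⌊n²/2⌋ + 1`, `Λ₀ = diag(0, 1, …, 1)` (`lamMatrix ℂ 0`, whose column `0` vanishes) and let
`Z_e ∈ ℂ^{m × m}` (`e ∈ [n] × [n]`) be constant matrices. The polynomial
`g = det(Λ₀ + Σ_e X_e Z_e) ∈ ℂ[x_e]` vanishes identically on the KERNEL PLANE
`V = {v | ∀ i, Σ_e v_e (Z_e)_{i 0} = 0}`: indeed `g(v) = det(Λ₀ + Σ_e v_e Z_e)`
(`RingHom.map_det`) and column `0` of that complex matrix is zero. `V` is the kernel of the linear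
map `v ↦ (Σ_e v_e (Z_e)_{i 0})_i : ℂ^{n × n} → ℂ^m`, so `dim V ≥ n² - m` by rank–nullity.

The stub states the vanishing in EXPANDED form, `Σ_{|μ| ≤ m} coeff_μ g · v^μ = 0`, which is
`g(v) = 0` because `deg g ≤ m` (`totalDegree_det_le_of_affine`, `totalDegree_lamPencil_le`) and
`MvPolynomial.eval_eq'`.
-/

noncomputable section

-- single-conjunct layout: Sub = Summit, duplicated namespace component intended
set_option linter.dupNamespace false

namespace Summit.ValiantsHypothesis.ValiantsHypothesis.Theorems.RefutationDegreeBeyondHessianNs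

open MvPolynomial Matrix
open Literature.Computability.AlgebraicComplexity

/-- The determinant of the pencil `Λ₀ + Σ_e X_e Z_e` with constant part `Λ₀ = diag(0,1,…,1)` of
size `⌊n²/2⌋ + 1` (local notation, byte-identical with the skeleton of the line `Sketch`). -/
local notation3 (prettyPrint := false) "pencilDet[" n ", " Z "]" =>
  (((Literature.Computability.AlgebraicComplexity.lamMatrix ℂ (0 : Fin (n ^ 2 / 2 + 1))).map MvPolynomial.C +
      ∑ e : Fin n × Fin n, (MvPolynomial.X e : MvPolynomial (Fin n × Fin n) ℂ) •
        (Z e).map (MvPolynomial.C : ℂ →+* MvPolynomial (Fin n × Fin n) ℂ) :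
      Matrix (Fin (n ^ 2 / 2 + 1)) (Fin (n ^ 2 / 2 + 1)) (MvPolynomial (Fin n × Fin n) ℂ)).det)

/-- The finite set of exponents of degree `≤ ⌊n²/2⌋ + 1` on the `n × n` variables (local notation,
byte-identical with the skeleton of the line `Sketch`). -/
local notation3 (prettyPrint := false) "degLE[" n "]" =>
  ((Finset.range (n ^ 2 / 2 + 1 + 1)).biUnion
    (fun k => (Finset.univ : Finset (Fin n × Fin n)).finsuppAntidiag k))

section General

variable {K : Type*} [CommRing K] {σ : Type*} [Fintype σ] {m : ℕ}

/-- The expanded evaluation formula over any finite set of exponents containing the support: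
`Σ_{μ ∈ S} coeff_μ g · v^μ = g(v)` (cf. `MvPolynomial.eval_eq'`). [folklore] -/
theorem sum_coeff_mul_prod_pow_eq_eval {S : Finset (σ →₀ ℕ)} {g : MvPolynomial σ K}
    (hS : g.support ⊆ S) (v : σ → K) :
    ∑ μ : ↥S, coeff μ.1 g * ∏ i, v i ^ (μ.1 i) = eval v g := by
  rw [Finset.sum_coe_sort S (fun μ => coeff μ g * ∏ i, v i ^ (μ i)), eval_eq']
  exact (Finset.sum_subset hS fun μ _ hμ => by rw [notMem_support_iff.mp hμ, zero_mul]).symm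

/-- Entrywise evaluation of the pencil: `(Λ_{i₀} + Σ_e X_e Z_e)(v) = Λ_{i₀} + Σ_e v_e Z_e`.
[folklore] -/
theorem map_eval_lamPencil (i₀ : Fin m) (Z : σ → Matrix (Fin m) (Fin m) K) (v : σ → K) :
    ((lamMatrix K i₀).map C + ∑ e : σ, (X e : MvPolynomial σ K) • (Z e).map
      (C : K →+* MvPolynomial σ K) : Matrix (Fin m) (Fin m) (MvPolynomial σ K)).map (eval v) =
      lamMatrix K i₀ + ∑ e : σ, v e • Z e := by
  ext i j
  simp [Matrix.map_apply, Matrix.add_apply, Matrix.sum_apply, Matrix.smul_apply, smul_eq_mul]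

/-- Column `i₀` of `Λ_{i₀}` vanishes. [folklore] -/
theorem lamMatrix_apply_self_eq_zero (i₀ i : Fin m) : lamMatrix K i₀ i i₀ = 0 := by
  rw [lamMatrix_apply]
  split_ifs <;> rfl

/-- **The kernel plane of a `Λ_{i₀}`-pencil**: if `Σ_e v_e (Z_e)_{i i₀} = 0` for all `i`, then
column `i₀` of `Λ_{i₀} + Σ_e v_e Z_e` vanishes, hence `det(Λ_{i₀} + Σ_e X_e Z_e)(v) = 0`.
[folklore] -/
theorem eval_det_lamPencil_eq_zero (i₀ : Fin m) (Z : σ → Matrix (Fin m) (Fin m) K) (v : σ → K)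
    (hv : ∀ i, ∑ e, v e * Z e i i₀ = 0) :
    eval v ((lamMatrix K i₀).map C + ∑ e : σ, (X e : MvPolynomial σ K) • (Z e).map
      (C : K →+* MvPolynomial σ K) : Matrix (Fin m) (Fin m) (MvPolynomial σ K)).det = 0 := by
  rw [RingHom.map_det, RingHom.mapMatrix_apply, map_eval_lamPencil]
  refine Matrix.det_eq_zero_of_column_eq_zero i₀ fun i => ?_
  rw [Matrix.add_apply, lamMatrix_apply_self_eq_zero, zero_add, Matrix.sum_apply]
  simpa only [Matrix.smul_apply, smul_eq_mul] using hv i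

end General

/-- **S4 — the kernel plane of a `Λ₀`-pencil, evaluated form** (stub `stub_kernelPlaneEval` of the
line `Sketch`): for constant matrices `Z_e` of size `m = ⌊n²/2⌋ + 1`, the polynomial
`g = det(Λ₀ + Σ_e X_e Z_e)` vanishes identically on the linear subspace
`V = {v : Σ_e v_e (Z_e)_{i0} = 0 ∀ i}` (the first column of `Λ₀ + Z(v)` vanishes),
`dim V ≥ n² - m` (rank–nullity), written as `Σ_{|μ| ≤ m} coeff_μ g · v^μ = 0` (`deg g ≤ m`).
[folklore] -/
theorem stub_kernelPlaneEval : ∀ (n : ℕ) (Z : Fin n × Fin n → Matrix (Fin (n ^ 2 / 2 + 1)) (Fin (n ^ 2 / 2 + 1)) ℂ), ∃ V : Submodule ℂ (Fin n × Fin n → ℂ), n ^ 2 ≤ Module.finrank ℂ V + (n ^ 2 / 2 + 1) ∧ ∀ v ∈ V, ∑ μ : ↥(degLE[n]), MvPolynomial.coeff μ.1 (pencilDet[n, Z]) * ∏ i, v i ^ (μ.1 i) = 0 := by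
  intro n Z
  -- the linear map `v ↦ (Σ_e v_e (Z_e)_{i 0})_i`, whose kernel is the kernel plane
  set f : (Fin n × Fin n → ℂ) →ₗ[ℂ] (Fin (n ^ 2 / 2 + 1) → ℂ) :=
    Matrix.mulVecLin (Matrix.of fun i e => Z e i 0) with hf
  refine ⟨LinearMap.ker f, ?_, ?_⟩
  · -- rank–nullity: `n² = rank f + null f ≤ m + dim V`
    have h1 := LinearMap.finrank_range_add_finrank_ker f
    have h2 : Module.finrank ℂ (LinearMap.range f) ≤ n ^ 2 / 2 + 1 := by
      calc Module.finrank ℂ (LinearMap.range f)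
          ≤ Module.finrank ℂ (Fin (n ^ 2 / 2 + 1) → ℂ) := Submodule.finrank_le _
        _ = n ^ 2 / 2 + 1 := by
          rw [Module.finrank_fintype_fun_eq_card, Fintype.card_fin]
    have h3 : Module.finrank ℂ (Fin n × Fin n → ℂ) = n ^ 2 := by
      rw [Module.finrank_fintype_fun_eq_card, Fintype.card_prod, Fintype.card_fin, sq]
    omega
  · -- vanishing on the kernel plane, in expanded form
    intro v hv
    rw [LinearMap.mem_ker] at hv
    rw [sum_coeff_mul_prod_pow_eq_eval (support_subset_biUnion_finsuppAntidiag
      (totalDegree_det_le_of_affine _ (totalDegree_lamPencil_le 0 Z))) v]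
    refine eval_det_lamPencil_eq_zero 0 Z v fun i => ?_
    have hi := congrFun hv i
    rw [hf, Matrix.mulVecLin_apply, Matrix.mulVec, Pi.zero_apply, dotProduct] at hi
    simp only [Matrix.of_apply] at hi
    rw [← hi]
    exact Finset.sum_congr rfl fun e _ => mul_comm _ _

end Summit.ValiantsHypothesis.ValiantsHypothesis.Theorems.RefutationDegreeBeyondHessianNs

end
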